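import Mathlib
import Summits.NavierStokesRegularity.NavierStokesRegularity.Theorems.TypeIQuarterGateScarEnvelopeTypeISatelliteTowerHullJunction

/-!
# Satellite tower for crux `ScarEnvelopeTypeI` (stmt-NavierStokesRegularity-23843) — Part Z2–Z3: the hull dichotomy of a rooted A–B object (T6 in census currency); the least past-DSS factor (H4)

Part Z2–Z3 of nsreg-p3 g28's ROUND-44 artefact: Z2 ★★ `RootObj.hullDichotomy` (every rooted A–B object has a ROOT ω-limit which is a rooted A–B object of
the same class and EITHER exactly `μ`-DSS on the open past, `μ > 1`, OR a.e. equal to a UNIFORMLY RECURRENT model with a DSS-free hull shadowing the object);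
Z3 ★ `pastDss_factors` (the past-DSS factors form `{1}` or `λ₀^ℤ` with `λ₀ ≥ Λ(M, 𝐈) > 1` — H4 + the a.e. ↔ pointwise transfer `ABTower.pastDss_iff_ae`).

PROVENANCE: declaration texts VERBATIM from the HOME artefact of the instrument seat nsreg-p3 g27 (cell `pub/ns-regularity-ideate`):
`round-44/Junction44.lean` (sha16 `ec5c26d3f01f4277`, parts `partZ1…partZ7.lean`; a module written against the TREE, importing route
RecurrentProfiles' crux-1589 dynamics modules BY NAME; memo `round-44/ROUND-44.md` c316de8a95807228), scored PASS ★★ by referee ref3 g27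
(`SCORE-p3-ROUND-44-0828.md` f10387a6f12e4133); the author cannot write under `Theorems/`
(`perm.theorems-prover-only`); landed by the prover ns-es-p1 g5 as landing hand of record (director-ns DIRECTOR-NS #237 (3)), split into
≤ 400-line modules, `E3` spelled out, the artefact's `#guard_msgs … #print axioms` certificates not landed.
`--supports stmt-NavierStokesRegularity-23843 --as helper`.

HONEST FRAMING: instrument theorems about HYPOTHETICAL Type-I zoom limits (Albritton–Barker objects of the census of crux
`TypeIQuarterGate.ScarEnvelopeTypeI`, item 23843); the analytic input is the tree's closure engine (compactness
`local_typeI_compactness_twin_inBall`, sharpened to constant 1 in Part S1; Q1 whole-space), P1 rate inheritance, L8 persistence and the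
tree's PROVED small-constant Liouville theorem; Parts R/S are order theory on the re-classing and closure lemmas.  NOTHING OPEN IS
PROVED: 23843, (L′) `TypeILiouvilleAB` / (L′₀), the GLOBAL (S∞) = `CritAttained`, (M𝐈₁), (E1⁺), (E2ᵣ), route ExtremalTypeIConstant's
cruxes, N0 and Navier–Stokes regularity are OPEN; `critRate`, `levelCrit I`, `liouvilleRate` are `sInf`s that are `0` by junk value
when the defining set is empty (every statement using them carries the nonemptiness hypothesis explicitly).
-/

-- the summit-side namespace repeats a component by design (single-conjunct summit, D-0017)
set_option linter.dupNamespace false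

open MeasureTheory Set Metric Filter Topology
open scoped ENNReal NNReal InnerProductSpace
open Literature.Analysis.FluidPDE

namespace Summit.NavierStokesRegularity.NavierStokesRegularity.Cruxes.ScarEnvelopeTypeI.ZoomDictionary

section HullJunction

variable {U U₁ U₂ W : ℝ → (EuclideanSpace ℝ (Fin 3)) → (EuclideanSpace ℝ (Fin 3))}
  {P : ℝ → (EuclideanSpace ℝ (Fin 3)) → ℝ}
  {H : ℝ → (EuclideanSpace ℝ (Fin 3)) → (EuclideanSpace ℝ (Fin 3)) →L[ℝ] (EuclideanSpace ℝ (Fin 3))}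
  {M : ℝ}

/-! ### Z2. T6 IN CENSUS CURRENCY: the hull dichotomy of a rooted A–B object -/

/-- `Q_R(0)` sits in the compact box `[-R², 0] × B̄_R(0) ⊆ {t ≤ 0} × ℝ³`. -/
theorem parabolicCylinder_subset_box (R : ℝ) :
    parabolicCylinder R (0 : ℝ × (EuclideanSpace ℝ (Fin 3))) ⊆
      Icc (-R ^ 2) 0 ×ˢ closedBall (0 : (EuclideanSpace ℝ (Fin 3))) R := by
  intro z hz
  rw [mem_parabolicCylinder] at hz
  refine ⟨⟨?_, ?_⟩, mem_closedBall.2 hz.2.le⟩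
  · have := hz.1.1; simp only [Prod.fst_zero] at this; linarith
  · have := hz.1.2; simp only [Prod.fst_zero] at this; exact this.le

/-- Slab profiles of crux 1589 (`𝐈 < ⊤` with a weak gradient) are `L³_loc` in the census sense. -/
theorem l3loc_of_slabProfile {w : ℝ → (EuclideanSpace ℝ (Fin 3)) → (EuclideanSpace ℝ (Fin 3))}
    {q : ℝ → (EuclideanSpace ℝ (Fin 3)) → ℝ}
    {G : ℝ → (EuclideanSpace ℝ (Fin 3)) → (EuclideanSpace ℝ (Fin 3)) →L[ℝ] (EuclideanSpace ℝ (Fin 3))}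
    (hwg : HasWeakSpatialGradientOn (slab (EuclideanSpace ℝ (Fin 3)) (Iio 0) isOpen_Iio) w G)
    (hI : typeIBound (Iio (0 : ℝ) ×ˢ univ) w q G < ⊤) : L3loc w :=
  fun _ hR => Summit.NavierStokesRegularity.NavierStokesRegularity.Theorems.memLp_three_of_slabProfile hwg hI hR

/-- Exact past self-similarity gives a.e. self-similarity on the slab. -/
theorem ae_dss_of_pastDss {c : ℝ} (h : ∀ t < 0, ∀ x, nsRescale c U t x = U t x) :
    ∀ᵐ z ∂(volume.restrict (Iio (0 : ℝ) ×ˢ (univ : Set (EuclideanSpace ℝ (Fin 3))))),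
      nsRescale c U z.1 z.2 = U z.1 z.2 :=
  ae_restrict_of_forall_mem (measurableSet_Iio.prod MeasurableSet.univ) fun z hz => h z.1 hz.1 z.2

/-- For A–B objects, a.e. self-similarity on the slab IS exact self-similarity on the open past. -/
theorem ABTower.pastDss_iff_ae (hT : ABTower M U P H) {c : ℝ} (hc : 0 < c) :
    (∀ t < 0, ∀ x, nsRescale c U t x = U t x) ↔
      ∀ᵐ z ∂(volume.restrict (Iio (0 : ℝ) ×ˢ (univ : Set (EuclideanSpace ℝ (Fin 3))))),
        nsRescale c U z.1 z.2 = U z.1 z.2 :=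
  ⟨ae_dss_of_pastDss, fun h => hT.pastDss_of_ae (W := U) hc (ae_of_all _ fun _ => rfl) h⟩

/-- ★★ **Z2. THE HULL DICHOTOMY OF A ROOTED A–B OBJECT** (T6 `stub_prBlowupDichotomy` of crux
`RecurrentLiouville`, stmt-1589, in census currency).  Every rooted A–B object `n` of the class `M` has a ROOT
ω-LIMIT `U'` — a ROOTED A–B object of the same class, `𝐈(U') ≤ 4·𝐈(n)`, the limit of the root zooms of `n.U`
along a null sequence of scales — which is

* EITHER **EXACTLY `μ`-DSS ON THE OPEN PAST** for some factor `μ > 1`: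
  `μ · U'(μ² t, μ x) = U'(t, x)` for every `t < 0` and every `x`;

* OR a.e. on every cylinder a member of the **HULL OF A UNIFORMLY RECURRENT, DSS-FREE MODEL**: there is a
  Type-I singularity model `w` of crux 1589 (class `M`, `𝐈 < ⊤`, singular origin) which is UNIFORMLY
  RECURRENT under scaling (`IsScalingUniformlyRecurrent`), whose whole `L³_loc`-hull carries no a.e.
  self-similarity of any factor `e^σ ≠ 1`, which SHADOWS `n.U` along the blow-up scales
  (`‖(n.U)_{λ_k} − w_{λ_k}‖_{L³(K)} → 0` on every compact `K ⊆ {t ≤ 0} × ℝ³`), and whose rescalings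
  `w_{λ_{φ k}}` converge to `U'` in every `L³(Q_R(0))`; in particular `U'` has NO past-DSS factor `c ≠ 1`. -/
theorem RootObj.hullDichotomy {n : TNode} (hn : RootObj M n) :
    (∃ (U' : ℝ → (EuclideanSpace ℝ (Fin 3)) → (EuclideanSpace ℝ (Fin 3))) (P' : ℝ → (EuclideanSpace ℝ (Fin 3)) → ℝ)
        (H' : ℝ → (EuclideanSpace ℝ (Fin 3)) → (EuclideanSpace ℝ (Fin 3)) →L[ℝ] (EuclideanSpace ℝ (Fin 3)))
        (lam : ℕ → ℝ) (μ : ℝ),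
        ABTower M U' P' H' ∧ ¬ RegPt U' 0 ∧
        typeIBound (Iio (0 : ℝ) ×ˢ univ) U' P' H' ≤ 4 * typeIBound (Iio (0 : ℝ) ×ˢ univ) n.U n.P n.H ∧
        IsRootOmegaLimit n.U U' ∧ (∀ k, 0 < lam k) ∧ Tendsto lam atTop (𝓝 0) ∧
        ZoomsTendsto n.U (fun _ => 0) lam U' ∧
        1 < μ ∧ ∀ t < 0, ∀ x, nsRescale μ U' t x = U' t x) ∨
    (∃ (U' : ℝ → (EuclideanSpace ℝ (Fin 3)) → (EuclideanSpace ℝ (Fin 3))) (P' : ℝ → (EuclideanSpace ℝ (Fin 3)) → ℝ)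
        (H' : ℝ → (EuclideanSpace ℝ (Fin 3)) → (EuclideanSpace ℝ (Fin 3)) →L[ℝ] (EuclideanSpace ℝ (Fin 3)))
        (w : ℝ → (EuclideanSpace ℝ (Fin 3)) → (EuclideanSpace ℝ (Fin 3))) (q : ℝ → (EuclideanSpace ℝ (Fin 3)) → ℝ)
        (G : ℝ → (EuclideanSpace ℝ (Fin 3)) → (EuclideanSpace ℝ (Fin 3)) →L[ℝ] (EuclideanSpace ℝ (Fin 3)))
        (lam : ℕ → ℝ) (φ : ℕ → ℕ),
        ABTower M U' P' H' ∧ ¬ RegPt U' 0 ∧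
        typeIBound (Iio (0 : ℝ) ×ˢ univ) U' P' H' ≤ 4 * typeIBound (Iio (0 : ℝ) ×ˢ univ) n.U n.P n.H ∧
        IsRootOmegaLimit n.U U' ∧ (∀ k, 0 < lam k) ∧ Tendsto lam atTop (𝓝 0) ∧ StrictMono φ ∧
        ZoomsTendsto n.U (fun _ => 0) (lam ∘ φ) U' ∧
        -- the uniformly recurrent DSS-free model `w` of crux 1589
        IsSuitableWeakSolutionOn (slab (EuclideanSpace ℝ (Fin 3)) (Iio 0) isOpen_Iio) 1 0 w q ∧
        HasWeakSpatialGradientOn (slab (EuclideanSpace ℝ (Fin 3)) (Iio 0) isOpen_Iio) w G ∧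
        typeIBound (Iio (0 : ℝ) ×ˢ univ) w q G < ⊤ ∧ HasTypeITimeDecay M w ∧
        IsBackwardSingularPoint w 0 ∧ IsScalingUniformlyRecurrent w ∧
        (∀ (v : ℝ → (EuclideanSpace ℝ (Fin 3)) → (EuclideanSpace ℝ (Fin 3))) (lam' : ℕ → ℝ),
          (∀ R : ℝ, 0 < R → MemLp (Function.uncurry v) 3
            (volume.restrict (parabolicCylinder R (0 : ℝ × (EuclideanSpace ℝ (Fin 3)))))) →
          (∀ k, 0 < lam' k) →
          (∀ R : ℝ, 0 < R → Tendsto (fun k => eLpNorm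
            (Function.uncurry (nsRescale (lam' k) w) - Function.uncurry v) 3
            (volume.restrict (parabolicCylinder R (0 : ℝ × (EuclideanSpace ℝ (Fin 3)))))) atTop (𝓝 0)) →
          ∀ σ : ℝ, (∀ᵐ z ∂(volume.restrict (Iio (0 : ℝ) ×ˢ (univ : Set (EuclideanSpace ℝ (Fin 3))))),
            nsRescale (Real.exp σ) v z.1 z.2 = v z.1 z.2) → σ = 0) ∧
        -- `w` shadows `n.U` along the blow-up scales
        (∀ K : Set (ℝ × (EuclideanSpace ℝ (Fin 3))), IsCompact K → K ⊆ Iic (0 : ℝ) ×ˢ univ →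
          Tendsto (fun k => eLpNorm (fun z : ℝ × (EuclideanSpace ℝ (Fin 3)) =>
            nsRescale (lam k) n.U z.1 z.2 - nsRescale (lam k) w z.1 z.2) 3 (volume.restrict K)) atTop (𝓝 0)) ∧
        -- `U'` lies in the hull of `w`
        (∀ R : ℝ, 0 < R → Tendsto (fun k => eLpNorm
          (Function.uncurry (nsRescale (lam (φ k)) w) - Function.uncurry U') 3
          (volume.restrict (parabolicCylinder R (0 : ℝ × (EuclideanSpace ℝ (Fin 3)))))) atTop (𝓝 0)) ∧
        -- hence `U'` has no past-DSS factor other than `1`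
        (∀ c : ℝ, 0 < c → (∀ t < 0, ∀ x, nsRescale c U' t x = U' t x) → c = 1)) := by
  obtain ⟨hsw, hwg, hI, hdec⟩ := hn.1.prClass
  rcases Summit.NavierStokesRegularity.NavierStokesRegularity.Theorems.stub_prBlowupDichotomy
      n.U n.P n.H M hsw hwg hI hdec hn.isBackwardSingularPoint with
    ⟨w, q, G, -, hwgw, -, -, -, ⟨μ, hμ, hdss⟩, lam, hlam, hlam0, hconv⟩ |
    ⟨w, q, G, hsww, hwgw, hIw, hdecw, hsingw, hrec, hfree, lam, hlam, hlam0, hshadow⟩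
  · -- the DSS branch: re-enter through the rooted representative of the limit `w`
    left
    obtain ⟨-, U', P', H', hT', h0', h4, hslab, -, hconvU, hω⟩ := hn.reentry hwgw hlam hlam0 hconv
    exact ⟨U', P', H', lam, μ, hT', h0', h4, hω, hlam, hlam0, hconvU, hμ,
      hT'.pastDss_of_ae (lt_trans zero_lt_one hμ) hslab hdss⟩
  · -- the recurrent branch: a convergent subsequence of the root zooms, shadowed by `w`
    right
    obtain ⟨U₀, P₀, H₀, φ, hφ, -, -, hω₀, hconv₀⟩ := hn.1.exists_isRootOmegaLimit hlam hlam0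
    obtain ⟨U', P', H', hT', h4, hae, h0'⟩ := abTower_of_isRootOmegaLimit hn.1 hn.2 hω₀
    have hconvU : ZoomsTendsto n.U (fun _ => 0) (lam ∘ φ) U' := hconv₀.congr_limit_ae hae
    have hω : IsRootOmegaLimit n.U U' :=
      ⟨hT'.l3loc, lam ∘ φ, fun k => hlam _, hlam0.comp hφ.tendsto_atTop, hconvU⟩
    have hw3 : L3loc w := l3loc_of_slabProfile hwgw hIw
    -- `w_{λ_{φ k}} → U'` in `L³(Q_R(0))`: shadowing on the box + convergence of the zooms of `n.U`
    have hhull : ∀ R : ℝ, 0 < R → Tendsto (fun k => eLpNorm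
        (Function.uncurry (nsRescale (lam (φ k)) w) - Function.uncurry U') 3
        (volume.restrict (parabolicCylinder R (0 : ℝ × (EuclideanSpace ℝ (Fin 3)))))) atTop (𝓝 0) := by
      intro R hR
      have hK : IsCompact (Icc (-R ^ 2) 0 ×ˢ closedBall (0 : (EuclideanSpace ℝ (Fin 3))) R) :=
        isCompact_Icc.prod (isCompact_closedBall 0 R)
      have hKs : Icc (-R ^ 2) 0 ×ˢ closedBall (0 : (EuclideanSpace ℝ (Fin 3))) R ⊆ Iic (0 : ℝ) ×ˢ univ :=
        prod_mono Icc_subset_Iic_self (subset_univ _)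
      have hA : Tendsto (fun k => eLpNorm (fun z : ℝ × (EuclideanSpace ℝ (Fin 3)) =>
          nsRescale (lam (φ k)) n.U z.1 z.2 - nsRescale (lam (φ k)) w z.1 z.2) 3
          (volume.restrict (parabolicCylinder R (0 : ℝ × (EuclideanSpace ℝ (Fin 3)))))) atTop (𝓝 0) := by
        refine tendsto_of_tendsto_of_tendsto_of_le_of_le tendsto_const_nhds
          ((hshadow _ hK hKs).comp hφ.tendsto_atTop) (fun _ => bot_le) fun k => ?_
        exact eLpNorm_mono_measure _ (Measure.restrict_mono (parabolicCylinder_subset_box R) le_rfl)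
      have hB := (zoomsTendsto_zero_iff_nsRescale.1 hconvU) R hR
      have hsum := hA.add hB
      rw [add_zero] at hsum
      refine tendsto_of_tendsto_of_tendsto_of_le_of_le tendsto_const_nhds hsum (fun _ => bot_le)
        fun k => ?_
      have hm1 : AEStronglyMeasurable (Function.uncurry (nsRescale (lam (φ k)) w))
          (volume.restrict (parabolicCylinder R (0 : ℝ × (EuclideanSpace ℝ (Fin 3))))) := by
        rw [← zoom_zero_eq_nsRescale]; exact ((hw3.galleryMap 0 (hlam _)) R hR).1
      have hm2 : AEStronglyMeasurable (Function.uncurry (nsRescale (lam (φ k)) n.U))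
          (volume.restrict (parabolicCylinder R (0 : ℝ × (EuclideanSpace ℝ (Fin 3))))) := by
        rw [← zoom_zero_eq_nsRescale]; exact ((hn.1.l3loc.galleryMap 0 (hlam _)) R hR).1
      have hm3 : AEStronglyMeasurable (Function.uncurry U')
          (volume.restrict (parabolicCylinder R (0 : ℝ × (EuclideanSpace ℝ (Fin 3))))) := (hT'.l3loc R hR).1
      have e : Function.uncurry (nsRescale (lam (φ k)) w) - Function.uncurry U' =
          (Function.uncurry (nsRescale (lam (φ k)) w) - Function.uncurry (nsRescale (lam (φ k)) n.U)) +
            (Function.uncurry (nsRescale (lam (φ k)) n.U) - Function.uncurry U') := by abel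
      rw [e]
      refine (eLpNorm_add_le (hm1.sub hm2) (hm2.sub hm3) (by norm_num)).trans (le_of_eq ?_)
      congr 1
      rw [← eLpNorm_neg]
      congr 1
      ext z
      simp only [Pi.neg_apply, Pi.sub_apply, neg_sub]
      rfl
    have hfreeU := hfree U' (lam ∘ φ) (fun R hR => hT'.l3loc R hR) (fun k => hlam _) hhull
    refine ⟨U', P', H', w, q, G, lam, φ, hT', h0', h4, hω, hlam, hlam0, hφ, hconvU, hsww, hwgw, hIw, hdecw,
      hsingw, hrec, hfree, hshadow, hhull, fun c hc hpast => ?_⟩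
    have h1 := hfreeU (Real.log c) (by rw [Real.exp_log hc]; exact ae_dss_of_pastDss hpast)
    rw [← Real.exp_log hc, h1, Real.exp_zero]

/-! ### Z3. THE LEAST FACTOR (H4 `stub_prScalingStabilizer` in census currency) -/

/-- `(e^{σ₀})^k = e^{k σ₀}` for integers `k`. -/
theorem exp_zpow_eq (σ₀ : ℝ) (k : ℤ) : Real.exp σ₀ ^ k = Real.exp ((k : ℝ) * σ₀) := by
  rw [← Real.rpow_intCast, mul_comm, Real.exp_mul]

/-- ★ **Z3. THE PAST-DSS FACTORS OF A ROOTED A–B OBJECT ARE `{1}` OR `λ₀^ℤ` WITH `λ₀ ≥ Λ(M, 𝐈-bound) > 1`**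
(H4 `stub_prScalingStabilizer` of crux `RecurrentLiouville`, stmt-1589: the a.e. scaling stabiliser is a
closed subgroup of `(ℝ,+)` containing no period in `(0, log Λ)` by the near-identity exclusion T2; for A–B
objects a.e. self-similarity on the slab is exact self-similarity on the open past, `ABTower.pastDss_iff_ae`).
In particular an exactly past-DSS rooted A–B object has a LEAST factor `λ₀ ≥ Λ` and all its factors are
the integer powers of `λ₀`. -/
theorem pastDss_factors (M : ℝ) (Mb : ℝ≥0∞) (hMb : Mb < ⊤) :
    ∃ Λ : ℝ, 1 < Λ ∧
      ∀ (U : ℝ → (EuclideanSpace ℝ (Fin 3)) → (EuclideanSpace ℝ (Fin 3))) (P : ℝ → (EuclideanSpace ℝ (Fin 3)) → ℝ)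
        (H : ℝ → (EuclideanSpace ℝ (Fin 3)) → (EuclideanSpace ℝ (Fin 3)) →L[ℝ] (EuclideanSpace ℝ (Fin 3))),
        ABTower M U P H → ¬ RegPt U 0 → typeIBound (Iio (0 : ℝ) ×ˢ univ) U P H ≤ Mb →
        (∀ c : ℝ, 0 < c → (∀ t < 0, ∀ x, nsRescale c U t x = U t x) → c = 1) ∨
        (∃ lam0 : ℝ, Λ ≤ lam0 ∧ (∀ t < 0, ∀ x, nsRescale lam0 U t x = U t x) ∧
          ∀ c : ℝ, 0 < c → ((∀ t < 0, ∀ x, nsRescale c U t x = U t x) ↔ ∃ k : ℤ, c = lam0 ^ k)) := by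
  obtain ⟨Λ, hΛ, h⟩ :=
    Summit.NavierStokesRegularity.NavierStokesRegularity.Theorems.stub_prScalingStabilizer M Mb hMb
  refine ⟨Λ, hΛ, fun U P H hT h0 hI => ?_⟩
  obtain ⟨hsw, hwg, -, hdec⟩ := hT.prClass
  have hsing : IsBackwardSingularPoint U (0 : ℝ × (EuclideanSpace ℝ (Fin 3))) := by
    rw [prod_zero_eq]; exact isBackwardSingularPoint_of_not_regPt h0
  rcases h U P H hsw hwg hI hdec hsing with htriv | ⟨σ₀, hσ₀, hstab⟩
  · left
    intro c hc hpast
    have h1 := htriv (Real.log c) (by rw [Real.exp_log hc]; exact ae_dss_of_pastDss hpast)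
    rw [← Real.exp_log hc, h1, Real.exp_zero]
  · right
    have hΛ0 : 0 < Λ := lt_trans zero_lt_one hΛ
    refine ⟨Real.exp σ₀, ?_, ?_, fun c hc => ?_⟩
    · calc Λ = Real.exp (Real.log Λ) := (Real.exp_log hΛ0).symm
        _ ≤ Real.exp σ₀ := Real.exp_le_exp.2 hσ₀
    · have h1 := (hstab σ₀).2 ⟨1, by simp⟩
      exact (hT.pastDss_iff_ae (Real.exp_pos σ₀)).2 h1
    · rw [hT.pastDss_iff_ae hc]
      constructor
      · intro hae
        obtain ⟨k, hk⟩ := (hstab (Real.log c)).1 (by rwa [Real.exp_log hc])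
        exact ⟨k, by rw [exp_zpow_eq, ← hk, Real.exp_log hc]⟩
      · rintro ⟨k, hk⟩
        have e : c = Real.exp ((k : ℝ) * σ₀) := by rw [hk, exp_zpow_eq]
        rw [e]
        exact (hstab _).2 ⟨k, rfl⟩

end HullJunction

end Summit.NavierStokesRegularity.NavierStokesRegularity.Cruxes.ScarEnvelopeTypeI.ZoomDictionary
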